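import Summits.QuantumFields.YangMills.Theses.TransverseWardBL
import Summits.QuantumFields.YangMills.Theorems.SoloInformedU1HelicityTorus
import Literature.MathematicalPhysics.QuantumFieldTheory.LatticeGaugeProofs
import Literature.MathematicalPhysics.QuantumLattice.HeatKernelGroupMeasureProofs
import HarnessLib

/-!
# Route `TransverseWardBL`, support `BoxSecondMoment` (stmt-QuantumFields-22931): `torusBoxVar β M N = ⟨f_h²⟩_{Λ_{M+1},β}`

Bookkeeping for Wilson `U(1)₄` on the torus `(ℤ/(M+1))⁴`: the node's two-point box sum
`torusBoxVar β M N = ∑_{x,y ∈ B_N} ⟨sin θ_{(x;0,1)} sin θ_{(y;0,1)}⟩_{Λ_{M+1},β}` (cylinder observables periodised by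
`toTorusObservable`) equals the torus second moment `⟨(∑_p h(p) sin θ_p)²⟩_{Λ_{M+1},β}` of the box 2-form
`h_(N,M)(y; 0,1) = #{x ∈ B_N : x ≡ y mod M+1}` (other orientations `0`).  Proof: `plaquette_torusLift` (periodisation of
`u1PlaqIm`), a fibrewise regrouping of `∑_{x ∈ B_N} sin θ_{(x mod M+1; 0,1)}` over the torus sites, and the bilinear expansion
of the square under the (probability) torus Wilson state, all observables being bounded and continuous.

Free-hands width seat `ym-t4-w11` (cell ym-fleet) for planner ym-idea-4 g9 (LINE g9-A).  THEOREMS ONLY; an identity between two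
finite-volume `U(1)` expectations — nothing about the Yang–Mills mass gap is proved.

References: J. Fröhlich, T. Spencer, Comm. Math. Phys. **83** (1982) 411 [FrohlichSpencer1982].
-/

set_option autoImplicit false

noncomputable section

open MeasureTheory Filter Topology Finset
open scoped BigOperators
open Literature.MathematicalPhysics.QuantumFieldTheory Literature.MathematicalPhysics.QuantumLattice
open Literature.Probability.LatticeModels
open Summit.QuantumFields.YangMills.Theorems.U1Helicity (torusBoxVar)

namespace Summit.QuantumFields.YangMills.Theorems.TransverseWardBL

variable {M : ℕ}

/-- The torus plaquette sine `U ↦ sin θ_{(z;0,1)}(U) = Im (plaquette holonomy)` is continuous in the configuration. [folklore] -/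
theorem continuous_torusPlaqIm (M : ℕ) (z : Site 4 (M + 1)) :
    Continuous fun U : GaugeConfig 4 (M + 1) Circle => ((plaquetteHolonomy U z 0 1 : Circle) : ℂ).im :=
  Complex.continuous_im.comp (continuous_subtype_val.comp (continuous_plaquetteHolonomy (G := Circle) z 0 1))

/-- Periodisation of the cylinder observable `sin θ_{(x;0,1)}`: `u1PlaqIm x 0 1 ∘ torusLift = sin θ_{(x mod M+1; 0,1)}`. [folklore] -/
theorem u1PlaqIm_torusLift (M : ℕ) (x : Literature.Probability.LatticeModels.Site 4) (U : GaugeConfig 4 (M + 1) Circle) :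
    u1PlaqIm x 0 1 (torusLift (M + 1) U) = ((plaquetteHolonomy U (Torus.proj (M + 1) x) 0 1 : Circle) : ℂ).im := by
  simp only [u1PlaqIm, plaquette_torusLift]

/-- Products of two periodised plaquette sines are integrable for the torus Wilson state. [folklore] -/
theorem integrable_torusPlaqIm_mul (β : ℝ) (M : ℕ) (z w : Site 4 (M + 1)) :
    Integrable (fun U : GaugeConfig 4 (M + 1) Circle =>
      ((plaquetteHolonomy U z 0 1 : Circle) : ℂ).im * ((plaquetteHolonomy U w 0 1 : Circle) : ℂ).im)
      (wilsonMeasure (L := M + 1) u1Rep β) := by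
  haveI := isProbabilityMeasure_wilsonMeasure (d := 4) (L := M + 1) u1Rep continuous_u1Rep β
  refine Integrable.of_bound
    (((continuous_torusPlaqIm M z).mul (continuous_torusPlaqIm M w)).measurable.aestronglyMeasurable) 1
    (ae_of_all _ fun U => ?_)
  rw [Real.norm_eq_abs, abs_mul]
  exact mul_le_one₀ (abs_im_le_one _) (abs_nonneg _) (abs_im_le_one _)

/-- The box 2-form paired with the plaquette sines regroups as the periodised box sum:
`∑_p h_(N,M)(p) sin θ_p = ∑_{x ∈ B_N} sin θ_{(x mod M+1; 0,1)}`. [folklore] -/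
theorem boxForm_sum_eq (M N : ℕ) (U : GaugeConfig 4 (M + 1) Circle) :
    (∑ p : Plaquette 4 (M + 1),
        (if p.2.1 = ((0 : Fin 4), (1 : Fin 4)) then
            (((box 4 N).filter (fun x => (fun i => ((x i : ℤ) : ZMod (M + 1))) = p.1)).card : ℝ)
          else 0) *
          ((plaquetteHolonomy U p.1 p.2.1.1 p.2.1.2 : Circle) : ℂ).im) =
      ∑ x ∈ box 4 N, ((plaquetteHolonomy U (Torus.proj (M + 1) x) 0 1 : Circle) : ℂ).im := by
  classical
  rw [Fintype.sum_prod_type]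
  have hinner : ∀ z : Site 4 (M + 1),
      (∑ q : {p : Fin 4 × Fin 4 // p.1 < p.2},
          (if q.1 = ((0 : Fin 4), (1 : Fin 4)) then
              (((box 4 N).filter (fun x => (fun i => ((x i : ℤ) : ZMod (M + 1))) = z)).card : ℝ)
            else 0) *
            ((plaquetteHolonomy U z q.1.1 q.1.2 : Circle) : ℂ).im) =
        (((box 4 N).filter (fun x => Torus.proj (M + 1) x = z)).card : ℝ) * ((plaquetteHolonomy U z 0 1 : Circle) : ℂ).im := by
    intro z
    rw [Finset.sum_eq_single (⟨((0 : Fin 4), (1 : Fin 4)), by decide⟩ : {p : Fin 4 × Fin 4 // p.1 < p.2})]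
    · simp only [if_true]
      rfl
    · intro q _ hq
      have hq' : q.1 ≠ ((0 : Fin 4), (1 : Fin 4)) := fun h => hq (Subtype.ext h)
      rw [if_neg hq', zero_mul]
    · intro h; exact absurd (Finset.mem_univ _) h
  simp_rw [hinner]
  rw [← Finset.sum_fiberwise (box 4 N) (Torus.proj (M + 1))
    (fun x => ((plaquetteHolonomy U (Torus.proj (M + 1) x) 0 1 : Circle) : ℂ).im)]
  refine Finset.sum_congr rfl fun z _ => ?_
  rw [Finset.sum_congr rfl (fun x (hx : x ∈ (box 4 N).filter (fun x => Torus.proj (M + 1) x = z)) =>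
      show ((plaquetteHolonomy U (Torus.proj (M + 1) x) 0 1 : Circle) : ℂ).im =
          ((plaquetteHolonomy U z 0 1 : Circle) : ℂ).im by rw [(Finset.mem_filter.mp hx).2]),
    Finset.sum_const, nsmul_eq_mul]

/-- **`BoxSecondMoment`** (item stmt-QuantumFields-22931), BY NAME: the node's `torusBoxVar β M N` is the torus second moment
`⟨f_h²⟩_{Λ_{M+1},β}` of the box form `h_(N,M)`. [cite: FrohlichSpencer1982, §2] -/
theorem boxSecondMoment_proof : Summit.QuantumFields.YangMills.Theses.TransverseWardBL.BoxSecondMoment := by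
  unfold Summit.QuantumFields.YangMills.Theses.TransverseWardBL.BoxSecondMoment
  intro β M N
  classical
  simp only
  have hsq : (fun U : GaugeConfig 4 (M + 1) Circle =>
      (∑ p : Plaquette 4 (M + 1),
        (if p.2.1 = ((0 : Fin 4), (1 : Fin 4)) then
            (((box 4 N).filter (fun x => (fun i => ((x i : ℤ) : ZMod (M + 1))) = p.1)).card : ℝ)
          else 0) *
          ((plaquetteHolonomy U p.1 p.2.1.1 p.2.1.2 : Circle) : ℂ).im) ^ 2) =
      fun U => ∑ x ∈ box 4 N, ∑ y ∈ box 4 N,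
        ((plaquetteHolonomy U (Torus.proj (M + 1) x) 0 1 : Circle) : ℂ).im *
          ((plaquetteHolonomy U (Torus.proj (M + 1) y) 0 1 : Circle) : ℂ).im := by
    funext U
    rw [boxForm_sum_eq, sq, Finset.sum_mul_sum]
  rw [hsq]
  unfold torusBoxVar wilsonExpectation
  rw [integral_finsetSum _ fun x _ => integrable_finsetSum _ fun y _ => integrable_torusPlaqIm_mul β M _ _]
  refine Finset.sum_congr rfl fun x _ => ?_
  rw [integral_finsetSum _ fun y _ => integrable_torusPlaqIm_mul β M _ _]
  refine Finset.sum_congr rfl fun y _ => ?_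
  congr 1
  funext U
  simp only [toTorusObservable_apply, u1PlaqIm_torusLift]

end Summit.QuantumFields.YangMills.Theorems.TransverseWardBL

end
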